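import Mathlib.Analysis.Complex.Trigonometric
import Mathlib.Analysis.SpecialFunctions.Trigonometric.Bounds
import Mathlib.Analysis.SpecialFunctions.Trigonometric.Inverse
import Mathlib.Analysis.Real.Pi.Bounds
import Literature.Geometry.DiscreteGeometry.KissingNodeDegree
import HarnessLib

/-!
# Rational brackets for the angle constants of the kissing linear programs

Topic `Literature/Geometry/DiscreteGeometry`.  The node equations and per-triangle angle bounds
of the fan-refined Delaunay triangulation of a twelve-point kissing configuration
(`SphericalCodeHullFanNodeSum.lean`, `IsoscelesContactTriangleAngles.lean`,
`SphericalExcessMonotone.lean`) are linear in the ANGLES; to draw combinatorial conclusions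
(vertex-star arithmetic, linear-programming certificates, Hales 2012 Lemma 9) one needs rational
brackets for the `arccos` constants that occur.  This file proves them, to four decimals
(the exclusions have margins of several degrees, `> 0.05` rad):

* Part A (tools): `cos_lower_quarter`, `cos_upper_quarter` — two-sided polynomial bounds for
  `cos x`, `0 ≤ x ≤ 2.6`, by halving twice (`cos x = 2 cos²(x/2) − 1`,
  `cos (x/2) = 1 − 2 sin²(x/4)`) and Mathlib's `sin_bound`, `sin_gt_sub_cube` at `x/4`;
  `lt_arccos_of_lt_cos`, `arccos_lt_of_cos_lt`.
* Part B (the constants):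
  `α₃ = arccos (1/3) ∈ (1.2308, 1.2311)` (`lt_arccos_third`, `arccos_third_lt`);
  `π − α₃ = arccos (−1/3) ∈ (1.9104, 1.9108)`; `2α₃ = arccos (−7/9) ∈ (2.4616, 2.4622)`;
  Hales's `α₄ = arccos ((4κ₀ − 1)/3) = arccos (−73/1250) ∈ (1.6291, 1.6293)`;
  the base-angle constants `arccos √(2/3) ∈ (0.6153, 0.6156)`, `arccos √(1/3) ∈ (0.9552, 0.9555)`,
  `arccos √((1 − κ₀)/(3 (1 + κ₀))) ∈ (1.0832, 1.0835)`; and `sol₀ = 3 α₃ − π < 0.5518`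
  (with `0.5475 < sol₀` in `KissingContactCount.lean`).

Everything is PROVED; no named facts.

## References
* T. C. Hales, arXiv:1209.6043 (2012), Lemma 7 (`α₃, α₄, β₄`), proof of Lemma 9. [`Hales2012`]
-/

noncomputable section

namespace Literature.Geometry.DiscreteGeometry

open Real

/-! ### Part A. Polynomial brackets for `cos` by double halving -/

section Tools

/-- **Lower bound**: for `0 ≤ x ≤ 2.6`,
`2 (1 − 2 u²)² − 1 ≤ cos x` with `u = x/4 − (x/4)³/6 + (x/4)⁵/100 ≥ sin (x/4)`. [folklore] -/
theorem cos_lower_quarter {x : ℝ} (hx0 : 0 ≤ x) (hx : x ≤ 2.6) :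
    2 * (1 - 2 * (x / 4 - (x / 4) ^ 3 / 6 + (x / 4) ^ 5 / 100) ^ 2) ^ 2 - 1 ≤ cos x := by
  set y := x / 4 with hy
  have hy0 : 0 ≤ y := by rw [hy]; linarith
  have hy1 : y ≤ 0.65 := by rw [hy]; linarith
  set u := y - y ^ 3 / 6 + y ^ 5 / 100 with hu
  -- `sin y ≤ u`
  have hsb := Real.sin_bound (show |y| ≤ 1 by rw [abs_of_nonneg hy0]; linarith)
  rw [abs_of_nonneg hy0] at hsb
  have hsin_le : sin y ≤ u := by
    have := (abs_sub_le_iff.1 hsb).1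
    rw [hu]; linarith
  have hsin0 : 0 ≤ sin y := sin_nonneg_of_nonneg_of_le_pi hy0 (by linarith [pi_gt_three])
  -- `u ≤ y ≤ 0.65`, so `c := 1 − 2u² ≥ 0`
  have hu_le : u ≤ y := by
    rw [hu]
    have : y ^ 5 / 100 ≤ y ^ 3 / 6 := by
      have h2 : y ^ 2 ≤ 1 := by nlinarith
      have : y ^ 5 = y ^ 3 * y ^ 2 := by ring
      rw [this]
      have hy3 : 0 ≤ y ^ 3 := by positivity
      nlinarith
    linarith
  have hu0 : 0 ≤ u := le_trans hsin0 hsin_le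
  have hc0 : 0 ≤ 1 - 2 * u ^ 2 := by nlinarith
  -- `cos (2y) = 1 − 2 sin² y ≥ 1 − 2 u²`
  have hcos2 : 1 - 2 * u ^ 2 ≤ cos (2 * y) := by
    rw [cos_two_mul, cos_sq']
    nlinarith
  -- `cos x = cos (2 · 2y) = 2 cos²(2y) − 1 ≥ 2 c² − 1`
  have hx4 : x = 2 * (2 * y) := by rw [hy]; ring
  rw [hx4, cos_two_mul (2 * y)]
  have hsq : (1 - 2 * u ^ 2) ^ 2 ≤ cos (2 * y) ^ 2 := pow_le_pow_left₀ hc0 hcos2 2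
  linarith

/-- **Upper bound**: for `0 ≤ x ≤ 2.6`,
`cos x ≤ 2 (1 − 2 v²)² − 1` with `v = x/4 − (x/4)³/6 ≤ sin (x/4)`. [folklore] -/
theorem cos_upper_quarter {x : ℝ} (hx0 : 0 ≤ x) (hx : x ≤ 2.6) :
    cos x ≤ 2 * (1 - 2 * (x / 4 - (x / 4) ^ 3 / 6) ^ 2) ^ 2 - 1 := by
  set y := x / 4 with hy
  have hy0 : 0 ≤ y := by rw [hy]; linarith
  have hy1 : y ≤ 0.65 := by rw [hy]; linarith
  set v := y - y ^ 3 / 6 with hv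
  have hv_le : v ≤ sin y := by
    rcases eq_or_lt_of_le hy0 with h | h
    · rw [hv, ← h]; simp
    · exact (Real.sin_gt_sub_cube h).le
  have hv0 : 0 ≤ v := by
    rw [hv]
    have h2 : y ^ 2 ≤ 6 := by nlinarith
    have : y ^ 3 = y * y ^ 2 := by ring
    nlinarith
  -- `cos (2y) = 1 − 2 sin² y ≤ 1 − 2 v²`, and `cos (2y) ≥ 0` as `2y ≤ 1.3 < π/2`
  have hcos2 : cos (2 * y) ≤ 1 - 2 * v ^ 2 := by
    rw [cos_two_mul, cos_sq']
    have : v ^ 2 ≤ sin y ^ 2 := pow_le_pow_left₀ hv0 hv_le 2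
    linarith
  have hcos2_nonneg : 0 ≤ cos (2 * y) :=
    cos_nonneg_of_neg_pi_div_two_le_of_le (by linarith [pi_gt_three]) (by linarith [pi_gt_three])
  have hx4 : x = 2 * (2 * y) := by rw [hy]; ring
  rw [hx4, cos_two_mul (2 * y)]
  have hsq : cos (2 * y) ^ 2 ≤ (1 - 2 * v ^ 2) ^ 2 := pow_le_pow_left₀ hcos2_nonneg hcos2 2
  linarith

/-- `q < cos t` with `t ∈ [0, π]` gives `t < arccos q` (`q ≥ −1`). [folklore] -/
theorem lt_arccos_of_lt_cos {t q : ℝ} (ht0 : 0 ≤ t) (htπ : t ≤ π) (hq : -1 ≤ q) (h : q < cos t) :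
    t < arccos q := by
  conv_lhs => rw [← arccos_cos ht0 htπ]
  exact arccos_lt_arccos hq h (cos_le_one t)

/-- `cos t < q` with `t ∈ [0, π]` gives `arccos q < t` (`q ≤ 1`). [folklore] -/
theorem arccos_lt_of_cos_lt {t q : ℝ} (ht0 : 0 ≤ t) (htπ : t ≤ π) (hq : q ≤ 1) (h : cos t < q) :
    arccos q < t := by
  conv_rhs => rw [← arccos_cos ht0 htπ]
  exact arccos_lt_arccos (neg_one_le_cos t) h hq

end Tools

/-! ### Part B. The constants -/

section Constants

/-- **`α₃ = arccos (1/3) > 1.2308`.** [cite: Hales2012, Lemma 7 (α₃ = dih of the regular tetrahedron)] -/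
theorem lt_arccos_third : (1.2308 : ℝ) < arccos (1 / 3) := by
  apply lt_arccos_of_lt_cos (by norm_num) (by linarith [pi_gt_three]) (by norm_num)
  refine lt_of_lt_of_le ?_ (cos_lower_quarter (by norm_num) (by norm_num))
  norm_num

/-- **`α₃ = arccos (1/3) < 1.2311`.** [cite: Hales2012, Lemma 7] -/
theorem arccos_third_lt : arccos (1 / 3) < (1.2311 : ℝ) := by
  apply arccos_lt_of_cos_lt (by norm_num) (by linarith [pi_gt_three]) (by norm_num)
  refine lt_of_le_of_lt (cos_upper_quarter (by norm_num) (by norm_num)) ?_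
  norm_num

/-- **`π − α₃ = arccos (−1/3) ∈ (1.9104, 1.9108)`** (the apex angle of the half-square).
[folklore] -/
theorem arccos_neg_third_bounds :
    (1.9104 : ℝ) < arccos (-(1 / 3)) ∧ arccos (-(1 / 3)) < 1.9108 := by
  rw [arccos_neg]
  constructor
  · linarith [arccos_third_lt, pi_gt_d6]
  · linarith [lt_arccos_third, pi_lt_d6]

/-- **`2 α₃ = arccos (−7/9)`** (`cos 2α₃ = −7/9` and `2α₃ ∈ [0, π]`). [folklore] -/
theorem arccos_neg_seven_ninths_eq : arccos (-(7 / 9) : ℝ) = 2 * arccos (1 / 3) := by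
  have h := cos_two_mul_arccos_third
  rw [show (-7 : ℝ) / 9 = -(7 / 9) by norm_num] at h
  rw [← h, arccos_cos]
  · linarith [arccos_nonneg (1 / 3 : ℝ)]
  · have : arccos (1 / 3 : ℝ) ≤ π / 2 := arccos_le_pi_div_two.2 (by norm_num)
    linarith

/-- **`2 α₃ = arccos (−7/9) ∈ (2.4616, 2.4622)`** (the apex bound of an isosceles contact
triangle in a facet). [folklore] -/
theorem arccos_neg_seven_ninths_bounds :
    (2.4616 : ℝ) < arccos (-(7 / 9)) ∧ arccos (-(7 / 9)) < 2.4622 := by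
  rw [arccos_neg_seven_ninths_eq]
  constructor
  · linarith [lt_arccos_third]
  · linarith [arccos_third_lt]

/-- **Hales's `α₄ = arccos ((4κ₀ − 1)/3) = arccos (−73/1250)`** (`κ₀ = 1031/5000`):
the arithmetic. [cite: Hales2012, Lemma 7 (α₄ = dih(2,2,2,2h₀,2,2))] -/
theorem four_mul_kappa0_sub_one_div_three : (4 * (1031 / 5000 : ℝ) - 1) / 3 = -(73 / 1250) := by
  norm_num

/-- **`α₄ = arccos (−73/1250) ∈ (1.6291, 1.6293)`**, via `arccos (−q) = π/2 + arcsin q` and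
`sin s − s³/6 < sin s < s`-type bounds at `s ≈ 0.0584`. [cite: Hales2012, Lemma 7 (α₄)] -/
theorem arccos_alpha4_bounds :
    (1.6291 : ℝ) < arccos (-(73 / 1250)) ∧ arccos (-(73 / 1250)) < 1.6293 := by
  rw [arccos_neg, arccos_eq_pi_div_two_sub_arcsin]
  -- `arcsin (73/1250) ∈ (0.0584, 0.05844)`
  have hlo : (0.0584 : ℝ) < arcsin (73 / 1250) := by
    rw [lt_arcsin_iff_sin_lt' ⟨by linarith [pi_gt_three], by linarith [pi_gt_three]⟩]
    have := Real.sin_lt (show (0 : ℝ) < 0.0584 by norm_num)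
    linarith
  have hhi : arcsin (73 / 1250) < (0.05844 : ℝ) := by
    rw [arcsin_lt_iff_lt_sin' ⟨by linarith [pi_gt_three], by linarith [pi_gt_three]⟩]
    have := Real.sin_gt_sub_cube (show (0 : ℝ) < 0.05844 by norm_num)
    refine lt_trans ?_ this
    norm_num
  constructor
  · linarith [pi_gt_d6]
  · linarith [pi_lt_d6]

/-- **`arccos √(2/3) ∈ (0.6153, 0.6156)`** (the least base angle of an isosceles contact triangle
in a facet, base cosine `> −1/3`). [folklore] -/
theorem arccos_sqrt_two_thirds_bounds :
    (0.6153 : ℝ) < arccos (Real.sqrt (2 / 3)) ∧ arccos (Real.sqrt (2 / 3)) < 0.6156 := by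
  have hs1 : Real.sqrt (2 / 3) ≤ 1 := by
    rw [Real.sqrt_le_one]; norm_num
  have hs0 : 0 ≤ Real.sqrt (2 / 3) := Real.sqrt_nonneg _
  constructor
  · apply lt_arccos_of_lt_cos (by norm_num) (by linarith [pi_gt_three]) (by linarith)
    -- `√(2/3) < L ≤ cos 0.6153` with `L² > 2/3`
    have hL := cos_lower_quarter (x := 0.6153) (by norm_num) (by norm_num)
    refine lt_of_lt_of_le ?_ hL
    rw [Real.sqrt_lt' (by norm_num)]
    norm_num
  · apply arccos_lt_of_cos_lt (by norm_num) (by linarith [pi_gt_three]) hs1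
    have hU := cos_upper_quarter (x := 0.6156) (by norm_num) (by norm_num)
    refine lt_of_le_of_lt hU ?_
    rw [Real.lt_sqrt (by norm_num)]
    norm_num

/-- **`arccos √(1/3) ∈ (0.9552, 0.9555)`** (the least base angle of a PAIRED isosceles contact
triangle, base cosine `≥ 0`; the half-square has exactly this base angle). [folklore] -/
theorem arccos_sqrt_third_bounds :
    (0.9552 : ℝ) < arccos (Real.sqrt (1 / 3)) ∧ arccos (Real.sqrt (1 / 3)) < 0.9555 := by
  have hs1 : Real.sqrt (1 / 3) ≤ 1 := by
    rw [Real.sqrt_le_one]; norm_num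
  constructor
  · apply lt_arccos_of_lt_cos (by norm_num) (by linarith [pi_gt_three])
      (by linarith [Real.sqrt_nonneg (1 / 3 : ℝ)])
    have hL := cos_lower_quarter (x := 0.9552) (by norm_num) (by norm_num)
    refine lt_of_lt_of_le ?_ hL
    rw [Real.sqrt_lt' (by norm_num)]
    norm_num
  · apply arccos_lt_of_cos_lt (by norm_num) (by linarith [pi_gt_three]) hs1
    have hU := cos_upper_quarter (x := 0.9555) (by norm_num) (by norm_num)
    refine lt_of_le_of_lt hU ?_
    rw [Real.lt_sqrt (by norm_num)]
    norm_num

/-- The arithmetic of the largest base angle: `(1 − κ₀)/(3 (1 + κ₀)) = 1323/6031`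
(`κ₀ = 1031/5000`). [folklore] -/
theorem one_sub_kappa0_div : (1 - (1031 / 5000 : ℝ)) / (3 * (1 + 1031 / 5000)) = 1323 / 6031 := by
  norm_num

/-- **`arccos √((1 − κ₀)/(3 (1 + κ₀))) = arccos √(1323/6031) ∈ (1.0832, 1.0835)`** (the largest
base angle of an isosceles contact triangle, base cosine `≤ κ₀`). [folklore] -/
theorem arccos_sqrt_kappa_bounds :
    (1.0832 : ℝ) < arccos (Real.sqrt (1323 / 6031)) ∧ arccos (Real.sqrt (1323 / 6031)) < 1.0835 := by
  have hs1 : Real.sqrt (1323 / 6031) ≤ 1 := by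
    rw [Real.sqrt_le_one]; norm_num
  constructor
  · apply lt_arccos_of_lt_cos (by norm_num) (by linarith [pi_gt_three])
      (by linarith [Real.sqrt_nonneg (1323 / 6031 : ℝ)])
    have hL := cos_lower_quarter (x := 1.0832) (by norm_num) (by norm_num)
    refine lt_of_lt_of_le ?_ hL
    rw [Real.sqrt_lt' (by norm_num)]
    norm_num
  · apply arccos_lt_of_cos_lt (by norm_num) (by linarith [pi_gt_three]) hs1
    have hU := cos_upper_quarter (x := 1.0835) (by norm_num) (by norm_num)
    refine lt_of_le_of_lt hU ?_
    rw [Real.lt_sqrt (by norm_num)]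
    norm_num

/-- **`sol₀ = 3 arccos (1/3) − π < 0.5518`** (with `0.5475 < sol₀`, `lt_hales_sol0`, this brackets
the solid angle of the regular spherical triangle of side `π/3`). [cite: Hales2012, §4 (sol₀)] -/
theorem three_mul_arccos_third_sub_pi_lt : 3 * arccos (1 / 3) - π < (0.5518 : ℝ) := by
  linarith [arccos_third_lt, pi_gt_d6]

end Constants

end Literature.Geometry.DiscreteGeometry

end
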